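import Mathlib
import HarnessLib
import Summits.Ventures.LatticeQCDFlow.Scoring.RegenerativeVarianceEstimator
import Summits.Ventures.LatticeQCDFlow.Scoring.RegenerativeTourLengthSquares

/-!
# The regenerative VARIANCE estimator, II (plug-in centring, Mykland–Tierney–Yu's `σ̂²`):
# `(1/R) Σ_{i=1}^R (Y_i − Â_R N_i)²` estimates the tour variance `v` — a CLT-free consistency certificate

HONEST FRAMING: exact (Metropolis-corrected) sampling algorithms for lattice gauge theory;
figures of merit are autocorrelation/cost numbers at stated couplings and volumes; no
continuum-physics claim.

Venture `LatticeQCDFlow` (cell pub-lqcd), topic `Scoring`; FANOUT row 8 (`s0-cpn-nemc`, GEN-17).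
NEW WORK of the cell, not a published result; no definition is introduced.  Notation of
`Scoring/RegenerativeEstimator.lean` / `Scoring/RegenerativeVarianceEstimator.lean`: tours `1, …, R`
from ANY start, `Y_i`, `N_i` the tour sums and lengths, `Â_R = Σ Y_i / Σ N_i` the tour estimator of
`π(f)`, `Z_i = Y_i − π(f) N_i`, `v = E_ν̂[Z_0²]`.  The estimator ACTUALLY computable from one run is
`V̂_R := (1/R) Σ_{i=1}^R (Y_i − Â_R N_i)²` (the unknown `π(f)` replaced by `Â_R`).  Three inputs:
(i) pathwise, since `|Z_i| ≤ 2C N_i` once the tours have ended, for EVERY real `Â`: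
`|(Y_i − Â N_i)² − Z_i²| ≤ (4C |Â − π(f)| + (Â − π(f))²) N_i²`; (ii) the squared tour lengths are
uncorrelated with fourth moment `≤ 24/ε⁴`, so `(1/R) Σ N_i² ≤ 3/ε²` except with probability `≤ 24/R`
(`Scoring/RegenerativeTourLengthSquares.lean`);
(iii) `|Â_R − π(f)| < s` except with probability `≤ 4((2−ε)(2C)²/s² + (1−ε))/R`
(`Scoring/RegenerativeEstimatorSharp.lean`).  With the oracle certificate this gives
`P(|V̂_R − v| ≥ a + 3(4Cs + s²)/ε²) ≤ [24(2C)⁴/(ε⁴a²) + 24 + 4((2−ε)(2C)²/s² + (1−ε))]/R` — the plug-in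
regenerative variance estimator is consistent, with an explicit CLT-free rate, from any start and
for every minorising law (and `ε v = σ²_f` by `Scoring/TourVarianceGeneral.lean`).  Printed
counterpart NAMED ONLY: Mykland–Tierney–Yu 1995 §3 (`σ̂²` of the regenerative method); Hobert–Jones–
Presnell–Rosenthal 2002 Thm 2 (its strong consistency) — nothing is cited as a fact.

## Content (`e = ε.toReal`; `0 < ε < 1`; any initial law; `π` invariant; `|f| ≤ C`; `R ≥ 1`; `a, s > 0`)

* `abs_sq_sub_sq_le` — `|(Z − dN)² − Z²| ≤ (4C|d| + d²) N²` for `|Z| ≤ 2C N`, `N ≥ 0`;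
* **`regenerative_variance_plugIn_confidence`** — THE CERTIFICATE displayed above.

NOT CLAIMED: optimal constants; a CLT or a confidence interval built from `V̂_R` (that needs a
Berry–Esseen-type input); unbounded `f`; any `ε` of a concrete sampler.
-/

noncomputable section

namespace Summit.Ventures.LatticeQCDFlow.Scoring

open MeasureTheory ProbabilityTheory Filter Finset Preorder Literature.Probability.MarkovChains
open scoped ENNReal

/-- **Plug-in versus oracle, one tour**: `|(Z − dN)² − Z²| ≤ (4C|d| + d²) N²` whenever `|Z| ≤ 2C N`
and `0 ≤ N`. -/
theorem abs_sq_sub_sq_le {Z N d C : ℝ} (hZ : |Z| ≤ 2 * C * N) (hN : 0 ≤ N) :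
    |(Z - d * N) ^ 2 - Z ^ 2| ≤ (4 * C * |d| + d ^ 2) * N ^ 2 := by
  have h1 : (Z - d * N) ^ 2 - Z ^ 2 = -(2 * d * Z * N) + d ^ 2 * N ^ 2 := by ring
  rw [h1]
  calc |-(2 * d * Z * N) + d ^ 2 * N ^ 2| ≤ |-(2 * d * Z * N)| + |d ^ 2 * N ^ 2| := abs_add_le _ _
    _ = 2 * |d| * |Z| * N + d ^ 2 * N ^ 2 := by
        rw [abs_neg, abs_mul, abs_mul, abs_mul, abs_of_nonneg hN, abs_two,
          abs_of_nonneg (by positivity : 0 ≤ d ^ 2 * N ^ 2)]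
    _ ≤ 2 * |d| * (2 * C * N) * N + d ^ 2 * N ^ 2 := by
        have := mul_le_mul_of_nonneg_left hZ (by positivity : 0 ≤ 2 * |d|)
        nlinarith [abs_nonneg d]
    _ = (4 * C * |d| + d ^ 2) * N ^ 2 := by ring

section PlugIn

variable {Ω : Type*} [MeasurableSpace Ω]
  {κ : Kernel Ω Ω} [IsMarkovKernel κ] {ν : Measure Ω} [IsProbabilityMeasure ν] {ε : ℝ≥0∞}
  {hmin : ∀ x {B : Set Ω}, MeasurableSet B → ε * ν B ≤ κ x B}
  (κs : Kernel (Ω × Bool) (Ω × Bool)) [IsMarkovKernel κs]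
  (μs : Measure (Ω × Bool)) [IsProbabilityMeasure μs]

/-- **THE PLUG-IN REGENERATIVE VARIANCE ESTIMATOR IS CONSISTENT (CLT-free).**  `π` invariant,
`κ(x, ·) ≥ ε ν`, `0 < ε < 1`, `|f| ≤ C` measurable, any initial law, `R ≥ 1`, `a, s > 0`; with
`Â_R = Σ_{i=1}^R Y_i / Σ_{i=1}^R N_i`, `V̂_R = (1/R) Σ_{i=1}^R (Y_i − Â_R N_i)²` and `v = E_{P̂_ν̂}[Z_0²]`:
`P(a + 3(4Cs + s²)/e² ≤ |V̂_R − v|) ≤ ((2C)⁴·24/(e⁴ a²) + 24 + 4((2−e)(2C)²/s² + (1−e)))/R`. -/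
theorem regenerative_variance_plugIn_confidence {π : Measure Ω} [IsProbabilityMeasure π]
    (hπ : Kernel.Invariant κ π) (hε0 : 0 < ε) (hε : ε < 1)
    (hκs : ∀ p, κs p = (ε • ν).map (fun y : Ω => (y, true))
      + ((1 - ε) • Doeblin.residualKernel κ ν ε hmin p.1).map (fun y : Ω => (y, false)))
    {f : Ω → ℝ} (hf : Measurable f) {C : ℝ} (hC : ∀ x, |f x| ≤ C) {R : ℕ} (hR : 0 < R)
    {a : ℝ} (ha : 0 < a) {s : ℝ} (hs : 0 < s) :
    (Kernel.trajMeasure (X := fun _ : ℕ => Ω × Bool) μs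
        (fun n : ℕ => κs.comap (fun h : (i : ↥(Finset.Iic n)) → Ω × Bool =>
          h ⟨n, Finset.mem_Iic.2 le_rfl⟩) (measurable_pi_apply _))).real
      {x | a + 3 * (4 * C * s + s ^ 2) / ε.toReal ^ 2
        ≤ |(∑ i ∈ Finset.range R, ((∑' u, (if (∑ s ∈ Finset.range u,
              (if (x (s + 1)).2 then (1 : ℕ) else 0)) = i + 1 then (1 : ℝ) else 0) * f (x u).1)
            - ((∑ i ∈ Finset.range R, ∑' u, (if (∑ s ∈ Finset.range u,
                (if (x (s + 1)).2 then (1 : ℕ) else 0)) = i + 1 then (1 : ℝ) else 0) * f (x u).1)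
              / (∑ i ∈ Finset.range R, ∑' u, (if (∑ s ∈ Finset.range u,
                (if (x (s + 1)).2 then (1 : ℕ) else 0)) = i + 1 then (1 : ℝ) else 0)))
            * (∑' u, (if (∑ s ∈ Finset.range u, (if (x (s + 1)).2 then (1 : ℕ) else 0)) = i + 1
              then (1 : ℝ) else 0))) ^ 2) / R
          - ∫ y, (∑' u, (if (∑ s ∈ Finset.range u, (if (y (s + 1)).2 then (1 : ℕ) else 0)) = 0
            then (1 : ℝ) else 0) * (f (y u).1 - ∫ z, f z ∂π)) ^ 2
            ∂(Kernel.trajMeasure (X := fun _ : ℕ => Ω × Bool) (ν.map (fun y : Ω => (y, true)))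
              (fun n : ℕ => κs.comap (fun h : (i : ↥(Finset.Iic n)) → Ω × Bool =>
                h ⟨n, Finset.mem_Iic.2 le_rfl⟩) (measurable_pi_apply _)))|}
      ≤ ((2 * C) ^ 4 * 24 / (ε.toReal ^ 4 * a ^ 2) + 24
          + 4 * ((2 - ε.toReal) * (2 * C) ^ 2 / s ^ 2 + (1 - ε.toReal))) / R := by
  haveI hνt : IsProbabilityMeasure (ν.map (fun y : Ω => (y, true))) :=
    Measure.isProbabilityMeasure_map (measurable_tagCoin true).aemeasurable
  set P := Kernel.trajMeasure (X := fun _ : ℕ => Ω × Bool) μs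
      (fun n : ℕ => κs.comap (fun h : (i : ↥(Finset.Iic n)) → Ω × Bool =>
        h ⟨n, Finset.mem_Iic.2 le_rfl⟩) (measurable_pi_apply _)) with hP
  set c := ∫ z, f z ∂π with hc
  set v := ∫ y, (∑' u, (if (∑ s ∈ Finset.range u, (if (y (s + 1)).2 then (1 : ℕ) else 0)) = 0
      then (1 : ℝ) else 0) * (f (y u).1 - c)) ^ 2
      ∂(Kernel.trajMeasure (X := fun _ : ℕ => Ω × Bool) (ν.map (fun y : Ω => (y, true)))
        (fun n : ℕ => κs.comap (fun h : (i : ↥(Finset.Iic n)) → Ω × Bool =>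
          h ⟨n, Finset.mem_Iic.2 le_rfl⟩) (measurable_pi_apply _))) with hv
  have he0 : 0 < ε.toReal := ENNReal.toReal_pos hε0.ne' (ne_top_of_lt hε)
  have hR0 : (0 : ℝ) < R := Nat.cast_pos.2 hR
  obtain ⟨-, hCg, -⟩ := centred_observable_bounds π hf hC
  have hC0 : 0 ≤ C := (abs_nonneg _).trans (hC (Classical.choice (nonempty_of_isProbabilityMeasure π)))
  -- the three good events
  have h1 := regenerative_variance_oracle_confidence κs μs (κ := κ) (ν := ν) (hmin := hmin) (π := π)
    hε0 hε hκs hf hC hR ha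
  have h2 := splitChain_sqTourLength_average_confidence κs μs (κ := κ) (ν := ν) (hmin := hmin) hε0 hε
    hκs hR
  have h3 := regenerative_estimator_confidence_sharp κs μs (κ := κ) (ν := ν) (hmin := hmin) hπ hε0 hε
    hκs hf hC hR hs
  rw [← hP, ← hc] at h1 h3
  rw [← hP] at h2
  rw [← hv] at h1
  -- almost surely: pathwise comparison of plug-in and oracle
  have hae := splitChain_ae_tourStart κs μs (κ := κ) (ν := ν) (hmin := hmin) hε0 hε hκs
  rw [← hP] at hae
  -- abbreviations inside the sets
  have hincl : ∀ᵐ x ∂P, x ∈ {x : ℕ → Ω × Bool | a + 3 * (4 * C * s + s ^ 2) / ε.toReal ^ 2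
        ≤ |(∑ i ∈ Finset.range R, ((∑' u, (if (∑ s ∈ Finset.range u,
              (if (x (s + 1)).2 then (1 : ℕ) else 0)) = i + 1 then (1 : ℝ) else 0) * f (x u).1)
            - ((∑ i ∈ Finset.range R, ∑' u, (if (∑ s ∈ Finset.range u,
                (if (x (s + 1)).2 then (1 : ℕ) else 0)) = i + 1 then (1 : ℝ) else 0) * f (x u).1)
              / (∑ i ∈ Finset.range R, ∑' u, (if (∑ s ∈ Finset.range u,
                (if (x (s + 1)).2 then (1 : ℕ) else 0)) = i + 1 then (1 : ℝ) else 0)))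
            * (∑' u, (if (∑ s ∈ Finset.range u, (if (x (s + 1)).2 then (1 : ℕ) else 0)) = i + 1
              then (1 : ℝ) else 0))) ^ 2) / R - v|}
      → x ∈ {x : ℕ → Ω × Bool | a ≤ |(∑ i ∈ Finset.range R, (∑' u, (if (∑ s ∈ Finset.range u,
            (if (x (s + 1)).2 then (1 : ℕ) else 0)) = i + 1 then (1 : ℝ) else 0)
            * (f (x u).1 - c)) ^ 2) / R - v|}
        ∪ {x : ℕ → Ω × Bool | 3 / ε.toReal ^ 2 ≤ (∑ i ∈ Finset.range R, (∑' u, (if (∑ s ∈ Finset.range u,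
            (if (x (s + 1)).2 then (1 : ℕ) else 0)) = i + 1 then (1 : ℝ) else 0)) ^ 2) / R}
        ∪ {x : ℕ → Ω × Bool | s ≤ |(∑ i ∈ Finset.range R, ∑' u, (if (∑ s ∈ Finset.range u,
            (if (x (s + 1)).2 then (1 : ℕ) else 0)) = i + 1 then (1 : ℝ) else 0) * f (x u).1)
          / (∑ i ∈ Finset.range R, ∑' u, (if (∑ s ∈ Finset.range u,
            (if (x (s + 1)).2 then (1 : ℕ) else 0)) = i + 1 then (1 : ℝ) else 0)) - c|} := by
    filter_upwards [hae] with x hx hbad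
    -- names
    set A := (∑ i ∈ Finset.range R, ∑' u, (if (∑ s ∈ Finset.range u,
        (if (x (s + 1)).2 then (1 : ℕ) else 0)) = i + 1 then (1 : ℝ) else 0) * f (x u).1)
      / (∑ i ∈ Finset.range R, ∑' u, (if (∑ s ∈ Finset.range u,
        (if (x (s + 1)).2 then (1 : ℕ) else 0)) = i + 1 then (1 : ℝ) else 0)) with hA
    set d := A - c with hd
    have hY : ∀ i : ℕ, (∑' u, (if (∑ s ∈ Finset.range u, (if (x (s + 1)).2 then (1 : ℕ) else 0))
        = i + 1 then (1 : ℝ) else 0) * f (x u).1)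
        = (∑' u, (if (∑ s ∈ Finset.range u, (if (x (s + 1)).2 then (1 : ℕ) else 0)) = i + 1
            then (1 : ℝ) else 0) * (f (x u).1 - c))
          + c * (∑' u, (if (∑ s ∈ Finset.range u, (if (x (s + 1)).2 then (1 : ℕ) else 0))
            = i + 1 then (1 : ℝ) else 0)) := by
      intro i
      obtain ⟨t₁, ht₁, hh₁⟩ := hx (i + 1)
      rw [tourSum_eq_finsetSum (fun p _ => f p.1 - c) x le_rfl ht₁ hh₁,
        tourSum_eq_finsetSum (fun p _ => f p.1) x le_rfl ht₁ hh₁,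
        tourLength_eq_finsetSum x le_rfl ht₁ hh₁, Finset.mul_sum, ← Finset.sum_add_distrib]
      exact Finset.sum_congr rfl fun u _ => by ring
    have hZN : ∀ i : ℕ, |∑' u, (if (∑ s ∈ Finset.range u, (if (x (s + 1)).2 then (1 : ℕ) else 0))
        = i + 1 then (1 : ℝ) else 0) * (f (x u).1 - c)|
        ≤ 2 * C * ∑' u, (if (∑ s ∈ Finset.range u, (if (x (s + 1)).2 then (1 : ℕ) else 0))
          = i + 1 then (1 : ℝ) else 0) := by
      intro i
      obtain ⟨t₁, ht₁, hh₁⟩ := hx (i + 1)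
      exact abs_tourSum_le_tourLength (ψ := fun p _ => f p.1 - c) (fun p _ => hCg p.1) x le_rfl ht₁ hh₁
    have hN0 : ∀ i : ℕ, 0 ≤ ∑' u, (if (∑ s ∈ Finset.range u, (if (x (s + 1)).2 then (1 : ℕ) else 0))
        = i + 1 then (1 : ℝ) else 0) := fun i => tsum_nonneg fun u => by split_ifs <;> norm_num
    -- the plug-in sum versus the oracle sum
    have hterm : ∀ i : ℕ, |((∑' u, (if (∑ s ∈ Finset.range u, (if (x (s + 1)).2 then (1 : ℕ) else 0))
          = i + 1 then (1 : ℝ) else 0) * f (x u).1)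
          - A * (∑' u, (if (∑ s ∈ Finset.range u, (if (x (s + 1)).2 then (1 : ℕ) else 0)) = i + 1
            then (1 : ℝ) else 0))) ^ 2
        - (∑' u, (if (∑ s ∈ Finset.range u, (if (x (s + 1)).2 then (1 : ℕ) else 0)) = i + 1
            then (1 : ℝ) else 0) * (f (x u).1 - c)) ^ 2|
        ≤ (4 * C * |d| + d ^ 2) * (∑' u, (if (∑ s ∈ Finset.range u,
            (if (x (s + 1)).2 then (1 : ℕ) else 0)) = i + 1 then (1 : ℝ) else 0)) ^ 2 := by
      intro i
      have h := abs_sq_sub_sq_le (d := d) (hZN i) (hN0 i)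
      rw [hY i]
      have hrw : (∑' u, (if (∑ s ∈ Finset.range u, (if (x (s + 1)).2 then (1 : ℕ) else 0)) = i + 1
            then (1 : ℝ) else 0) * (f (x u).1 - c))
          + c * (∑' u, (if (∑ s ∈ Finset.range u, (if (x (s + 1)).2 then (1 : ℕ) else 0))
            = i + 1 then (1 : ℝ) else 0))
          - A * (∑' u, (if (∑ s ∈ Finset.range u, (if (x (s + 1)).2 then (1 : ℕ) else 0)) = i + 1
            then (1 : ℝ) else 0))
          = (∑' u, (if (∑ s ∈ Finset.range u, (if (x (s + 1)).2 then (1 : ℕ) else 0)) = i + 1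
            then (1 : ℝ) else 0) * (f (x u).1 - c))
          - d * (∑' u, (if (∑ s ∈ Finset.range u, (if (x (s + 1)).2 then (1 : ℕ) else 0))
            = i + 1 then (1 : ℝ) else 0)) := by rw [hd]; ring
      rw [hrw]
      exact h
    have hdiff : |(∑ i ∈ Finset.range R, ((∑' u, (if (∑ s ∈ Finset.range u,
          (if (x (s + 1)).2 then (1 : ℕ) else 0)) = i + 1 then (1 : ℝ) else 0) * f (x u).1)
          - A * (∑' u, (if (∑ s ∈ Finset.range u, (if (x (s + 1)).2 then (1 : ℕ) else 0)) = i + 1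
            then (1 : ℝ) else 0))) ^ 2) / R
        - (∑ i ∈ Finset.range R, (∑' u, (if (∑ s ∈ Finset.range u,
          (if (x (s + 1)).2 then (1 : ℕ) else 0)) = i + 1 then (1 : ℝ) else 0) * (f (x u).1 - c)) ^ 2) / R|
        ≤ (4 * C * |d| + d ^ 2) * ((∑ i ∈ Finset.range R, (∑' u, (if (∑ s ∈ Finset.range u,
          (if (x (s + 1)).2 then (1 : ℕ) else 0)) = i + 1 then (1 : ℝ) else 0)) ^ 2) / R) := by
      rw [← sub_div, abs_div, abs_of_pos hR0, ← Finset.sum_sub_distrib, mul_div_assoc', Finset.mul_sum]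
      refine div_le_div_of_nonneg_right ((Finset.abs_sum_le_sum_abs _ _).trans
        (Finset.sum_le_sum fun i _ => hterm i)) hR0.le
    -- outside the three events the error is small
    by_contra hnot
    simp only [Set.mem_union, Set.mem_setOf_eq, not_or, not_le] at hnot
    obtain ⟨⟨h1x, h2x⟩, h3x⟩ := hnot
    rw [← hA, ← hd] at h3x
    have hd' : |d| < s := h3x
    have hcoef : 4 * C * |d| + d ^ 2 ≤ 4 * C * s + s ^ 2 := by
      have hd2 : d ^ 2 ≤ s ^ 2 := by
        rw [← sq_abs]; exact pow_le_pow_left₀ (abs_nonneg d) hd'.le 2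
      nlinarith [abs_nonneg d]
    have hQ0 : 0 ≤ (∑ i ∈ Finset.range R, (∑' u, (if (∑ s ∈ Finset.range u,
        (if (x (s + 1)).2 then (1 : ℕ) else 0)) = i + 1 then (1 : ℝ) else 0)) ^ 2) / R :=
      div_nonneg (Finset.sum_nonneg fun i _ => sq_nonneg _) hR0.le
    have hbound := hdiff.trans (mul_le_mul hcoef h2x.le hQ0 (by positivity))
    have htri := abs_sub_le ((∑ i ∈ Finset.range R, ((∑' u, (if (∑ s ∈ Finset.range u,
          (if (x (s + 1)).2 then (1 : ℕ) else 0)) = i + 1 then (1 : ℝ) else 0) * f (x u).1)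
          - A * (∑' u, (if (∑ s ∈ Finset.range u, (if (x (s + 1)).2 then (1 : ℕ) else 0)) = i + 1
            then (1 : ℝ) else 0))) ^ 2) / R)
      ((∑ i ∈ Finset.range R, (∑' u, (if (∑ s ∈ Finset.range u,
          (if (x (s + 1)).2 then (1 : ℕ) else 0)) = i + 1 then (1 : ℝ) else 0) * (f (x u).1 - c)) ^ 2) / R)
      v
    have h3e : (4 * C * s + s ^ 2) * (3 / ε.toReal ^ 2) = 3 * (4 * C * s + s ^ 2) / ε.toReal ^ 2 := by
      ring
    linarith
  -- assemble
  calc P.real _ ≤ P.real ({x : ℕ → Ω × Bool | a ≤ |(∑ i ∈ Finset.range R, (∑' u, (if (∑ s ∈ Finset.range u,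
            (if (x (s + 1)).2 then (1 : ℕ) else 0)) = i + 1 then (1 : ℝ) else 0)
            * (f (x u).1 - c)) ^ 2) / R - v|}
        ∪ {x : ℕ → Ω × Bool | 3 / ε.toReal ^ 2 ≤ (∑ i ∈ Finset.range R, (∑' u, (if (∑ s ∈ Finset.range u,
            (if (x (s + 1)).2 then (1 : ℕ) else 0)) = i + 1 then (1 : ℝ) else 0)) ^ 2) / R}
        ∪ {x : ℕ → Ω × Bool | s ≤ |(∑ i ∈ Finset.range R, ∑' u, (if (∑ s ∈ Finset.range u,
            (if (x (s + 1)).2 then (1 : ℕ) else 0)) = i + 1 then (1 : ℝ) else 0) * f (x u).1)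
          / (∑ i ∈ Finset.range R, ∑' u, (if (∑ s ∈ Finset.range u,
            (if (x (s + 1)).2 then (1 : ℕ) else 0)) = i + 1 then (1 : ℝ) else 0)) - c|}) :=
        ENNReal.toReal_mono (measure_ne_top _ _) (measure_mono_ae hincl)
    _ ≤ P.real ({x : ℕ → Ω × Bool | a ≤ |(∑ i ∈ Finset.range R, (∑' u, (if (∑ s ∈ Finset.range u,
            (if (x (s + 1)).2 then (1 : ℕ) else 0)) = i + 1 then (1 : ℝ) else 0)
            * (f (x u).1 - c)) ^ 2) / R - v|}
        ∪ {x : ℕ → Ω × Bool | 3 / ε.toReal ^ 2 ≤ (∑ i ∈ Finset.range R, (∑' u, (if (∑ s ∈ Finset.range u,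
            (if (x (s + 1)).2 then (1 : ℕ) else 0)) = i + 1 then (1 : ℝ) else 0)) ^ 2) / R})
        + P.real {x : ℕ → Ω × Bool | s ≤ |(∑ i ∈ Finset.range R, ∑' u, (if (∑ s ∈ Finset.range u,
            (if (x (s + 1)).2 then (1 : ℕ) else 0)) = i + 1 then (1 : ℝ) else 0) * f (x u).1)
          / (∑ i ∈ Finset.range R, ∑' u, (if (∑ s ∈ Finset.range u,
            (if (x (s + 1)).2 then (1 : ℕ) else 0)) = i + 1 then (1 : ℝ) else 0)) - c|} :=
        measureReal_union_le _ _
    _ ≤ ((2 * C) ^ 4 * 24 / (ε.toReal ^ 4 * a ^ 2 * R) + 24 / R)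
        + 4 * ((2 - ε.toReal) * (2 * C) ^ 2 / s ^ 2 + (1 - ε.toReal)) / R :=
        add_le_add ((measureReal_union_le _ _).trans (add_le_add h1 h2)) h3
    _ = _ := by
        field_simp

end PlugIn

end Summit.Ventures.LatticeQCDFlow.Scoring

end
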